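import Mathlib
import HarnessLib
import HarnessLib.Audit
import Summits.QuantumFields.Statement
import Summits.QuantumFields.YangMills.Theses.BalabanLadder
import Summits.QuantumFields.YangMills.Theses.BalabanFamilyExport
import Summits.QuantumFields.YangMills.Theorems.BalabanLadderUVTorusClassDefs
import Summits.QuantumFields.YangMills.Theorems.BalabanLadderUVTorusDictionary
import Literature.MathematicalPhysics.QuantumFieldTheory.Balaban1983to89.BlockAveragingSU2
import HarnessLib.Audit.Status.Attr

/-!
Route: BalabanTowerExport

# Route BalabanTowerExport — Reverse-martingale tower across Bałaban's block levels — summable level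
weights export E0′ to the spine crux with decoupling only in the deep regime

X = TowerDecoupling ∧ TowerExportGlue ∧ CondResponse ∧ FamilySeam ∧ FloorsEngine ("it suffices to
show"), a D-0145 LINE (ideator ym-idea-9 g3, lens «complete» = programme-completion) on the spine
crux `BalabanLadder.UVSeamRec` = item stmt-QuantumFields-20043 (LADDER-YM R2d; bears_on rung
R2d/20043, upstream R4 = 19351 `UV`). THE TOWER: write the centred plaquette as the telescoping sum
over ALL of Bałaban's block levels, X_i = p_i − E p_i = Σ_(a=0..k) D_i^(a) with D_i^(a) = E[p_i |
Q_a] − E[p_i | Q_(a+1)] (a < k; Q_a = a-fold `blockAvg su2Mean`, σ(Q_0) ⊇ σ(Q_1) ⊇ … a REVERSE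
filtration) and D_i^(k) = E[p_i | Q_k] − E p_i, using the EVERYWHERE-bounded versions of
`CondResponse` at every depth (|D^(a)| ≤ 2C_R·L^(−4a)). Expand E ∏_i X_i = Σ over level assignments
j⃗ ∈ {0..k}^n of T(j⃗) = E ∏_i D_i^(j_i). The two top levels (k−1, k) already have sup size ≤
2C_R·L⁸/b⁴ (b = L^k) and are absorbed into a bounded σ(Q_(k−1))-measurable tilt Φ; every lower level
a ≤ k−2 is handled by ONE crux, `TowerDecoupling`: a multi-level conditional cluster bound |∫ ∏_(low
i) (u_i∘Q_(a_i) − h_i∘Q_(a_i+1)) · Φ∘Q_(k−1) dμ| ≤ ∏_i (C₁·(L^(a_i+1)/L^k)^(4+δ)·s_i) · ∫|Φ∘Q_(k−1)|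
dμ for exactly-centred level differences of conditional expectations of 34·L^k-separated plaquettes
(s_i = their sup sizes). The bound is a PRODUCT over insertions, so Σ_(j⃗) |T(j⃗)| ≤ (Σ_(j=0..k)
w(j))^n with Σ_j w(j) ≤ C″·L^(−4k), C″ = 2C_R(2L⁸ + C₁L⁴Σ_(t≥1) L^(−δt)): n-UNIFORMITY of E0′ is
AUTOMATIC from summable level weights, the precision b⁻⁴ comes ENTIRELY from the one-point sizes
(CondResponse, compactness-safe), and decoupling is asked ONLY in the deep regime — separation ≥
34·L block-lengths of the depth-(a+1) constrained system, i.e. scale ratio ≥ L — and only at POWER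
rate 4+δ in the scale ratio (the truth is exponential). `TowerExportGlue` (support, provable now) is
this bookkeeping into `BalabanFamilyExport.FamilyCeilings`; `FamilySeam`/`FloorsEngine` are the
shared legs (25033/25034). No summit, leg or crux is proved by this line; UV (19351), NT, IR remain
open; the route is born draft (closes concludes the leaf UVSeamRec; alt-closer registration R407(b)
pending).
Lean: `Summit.QuantumFields.YangMills.Theses.BalabanTowerExport.TowerDecoupling ∧
Summit.QuantumFields.YangMills.Theses.BalabanTowerExport.TowerExportGlue ∧
Summit.QuantumFields.YangMills.Theses.BalabanTowerExport.CondResponse ∧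
Summit.QuantumFields.YangMills.Theses.BalabanTowerExport.FamilySeam ∧
Summit.QuantumFields.YangMills.Theses.BalabanTowerExport.FloorsEngine`

## Assembly
Kernel-checked in glue.lean (rc 0, no sorry): `closes h₁ h₂ h₃ h₄ h₅ := BalabanFamilyExport.closes
(h₂ h₁ h₃) h₄ h₅` — the tower glue turns multi-level decoupling + one-point response into
`FamilyCeilings`, and BFE's deciding theorem carries ceilings + seam + floors to
`Summit.QuantumFields.YangMills.Theses.BalabanLadder.UVSeamRec` BY NAME
(CondResponse/FamilySeam/FloorsEngine restated verbatim = items 26018/25033/25034, dedup-shared).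

Rationale: WHY THIS LINE. PROGRAMME-COMPLETION of Bałaban's own induction [Balaban1985Averaging,
Balaban1987RG1, Balaban1988Convergent, Balaban1989LargeFieldII]: the printed programme controls
EFFECTIVE ACTIONS level by level and stops before observables (STATE-OF-THE-CRUX-20043-g10 §B2); the
listed export routes read the programme at ONE depth k (BalabanFluctuationExport: n-point
`CondDecoupling` 26017 at 2 correlation lengths with b⁻⁴ precision; BalabanMarkovExport: joint shell
stability at depth k) — this line reads it AS A TOWER, the way the programme is actually proved. The
imported device is the backward-filtration martingale of the renormalised potential along an RG flow
(Polchinski-flow form: Bauerschmidt–Bodineau–Dagallier [corpus:paper:arxiv-2307.07619 p.25 §4.4],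
used there for log-Sobolev/decay in scalar and spin systems [arXiv:1907.12308, arXiv:2202.02295]);
here the filtration is Bałaban's discrete, nonlinear, gauge-covariant block-averaging tower σ(Q_a)
and the martingale is (E[p_x | Q_a])_a for one plaquette. What the transplant buys, in two lines of
arithmetic: (1) level differences have sizes 2C_R·L^(−4a) for free (one-point `CondResponse` at each
depth), so an insertion sitting at level a needs only the factor (L^(a+1)/L^k)^(4+δ) from decoupling
— available in the DEEP regime, where the depth-(a+1) constrained fluctuation field is massive on
scale L^(a+1) [Balaban1985BackgroundPropagators] and the insertions are ≥ 34·L^(k−a−1) ≥ 34L such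
lengths apart; (2) the per-term bound is multiplicative over insertions, so the (k+1)^n level
assignments re-sum to (Σ_j w(j))^n and uniformity in n costs nothing. Compared with 26017 the
decoupling statement moves from the HARD end of any cluster expansion (precision b⁻⁴ at separation
2b, uniform in rough W) to its EASY end (any power > 4 of the scale ratio at separation ≥ 34L
correlation lengths), at the price of asking it at every depth a+1 ≤ k−1 simultaneously (one
multi-level statement, tilt at depth k−1).

RANKED CRUXES. #2 TowerDecoupling (crux) — for every admissible L (odd, > 11) there are C₁ ≥ 0, δ >
0, β₄, ℓ₄ > 0 such that for β ≥ β₄, on every family torus (F, K) with F.L = L and every depth k with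
k+2 ≤ m+K and L^k·uRec β ≤ ℓ₄: for every m, every family of plane plaquettes p_i = p_(q_i, x_i)
pairwise 34·L^k(+4)-separated (cyclically, in some coordinate), every level assignment a_i with a_i
+ 2 ≤ k, every versions u_i of E[p_i | Q_(a_i)] and h_i of E[p_i | Q_(a_i+1)] (bounded; u_i∘Q_(a_i),
h_i∘Q_(a_i+1) measurable; orthogonality ∫(p_i − u_i∘Q_(a_i))·φ∘Q_(a_i) dμ = 0 and ∫(p_i −
h_i∘Q_(a_i+1))·φ∘Q_(a_i+1) dμ = 0 for all bounded measurable tilts φ), every sup sizes s_i ≥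
|u_i∘Q_(a_i) − h_i∘Q_(a_i+1)|, and every tilt Φ with Φ∘Q_(k−1) measurable and |Φ| ≤ 1: |∫ ∏_i
(u_i(Q_(a_i)V) − h_i(Q_(a_i+1)V)) · Φ(Q_(k−1)V) dμ(V)| ≤ (∏_i C₁·((L^(a_i+1))/(L^k))^(4+δ)·s_i) · ∫
|Φ(Q_(k−1)V)| dμ(V), μ = SU(2) Wilson measure at β on the torus (F.P K).sitesPerDir 0. [difficulty:
XL] (why it might fail: Uniformity in the depth-(k−1) block field via Φ: near-central coarse
holonomies (angle π−ε, weight ≈ e^(−βπ²/2) per coarse plaquette) leave weakly pinned degenerate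
valleys of the constrained minimiser whose conditional correlations may decay slower than any fixed
power of the scale ratio as ε → 0.) [Balaban1985BackgroundPropagators, Balaban1985Averaging,
Balaban1987RG1, Balaban1989LargeFieldII, Balaban1998FluctuationMeasures, arXiv:2307.07619,
arXiv:1907.12308]
#3 CondResponse (crux) — shared verbatim with route BalabanFluctuationExport (item
stmt-QuantumFields-26272's parent family: 26018): for every admissible L there are C ≥ 0, β₄, ℓ₄ > 0
such that in the window, for every plane plaquette p_x there is a version g of E[p_x | Q_k] with
g∘Q_k measurable, |g(W) − E p_x| ≤ C/(L^k)⁴ for EVERY block field W, and orthogonality to every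
bounded test function of the block field (one-point conditional response, sup form over the COARSE
field only — compactness caps the W-forced fine curvature at π/b²). [difficulty: L] (why it might
fail: «sup over all W» must survive block fields far in the tail (maximally frustrated coarse
holonomies, near-degenerate su2Mean averages) where E[p_x | W] − E p_x is set by the forced fine
curvature; if some W forces action concentration near x beyond O(b⁻⁴) the sup form is false.)
[Balaban1985BackgroundPropagators, Balaban1985Averaging, Balaban1987RG1,
Balaban1998FluctuationMeasures, Luscher1983]
#4 FamilySeam (crux) — shared verbatim with routes BalabanFamilyExport / BalabanFluctuationExport
(item 25033): ceilings on the one-parameter family of tori M = 2·Lⁿ transfer to the full class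
MomentBounds6 (thermodynamic transfer + finite-volume odd ceilings; split 25259/25260 lives in
BalabanFamilyExport). [difficulty: L] (why it might fail: The transfer from the sides 2·Lⁿ to all
tori needs a volume-monotonicity or thermodynamic-limit comparison of 6-plaquette moments at fixed β
that no correlation inequality provides for SU(2); finite odd tori may carry toron shifts ≥ C/R⁴ at
the smallest admissible sizes.) [Balaban1988Convergent, Luscher1983, Balaban1985Averaging]
#5 FloorsEngine (crux) — shared verbatim with routes BalabanFamilyExport / BalabanFluctuationExport
(item 25034): the non-triviality floors (Q2 two-point floor and Q3 three-point floor at physical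
scale a(β) ≍ uRec β) — the NT desk's engine (19353 territory), unchanged. [difficulty: XL] (why it
might fail: The Q3 floor is a non-perturbative lower bound on a connected three-point function at
the physical scale; perturbatively it is O(g²) → 0 and no printed argument bounds it below uniformly
in β (PerturbativeInvisibility barrier applies head-on; shared bet with v5(α)/BFE).)
[Balaban1989LargeFieldII, Luscher1983]
#9 TowerExportGlue (support) — TowerDecoupling → CondResponse → BalabanFamilyExport.FamilyCeilings:
take L := 13, class tori M = 2·13ⁿ realised as (F.P K).sitesPerDir 0; given R ≥ 17·13 pick k ≥ 1
with 13^k ≤ R/17 < 13^(k+1) (window 13^k·uRec ≤ ℓ₄ from R·uRec ≤ ℓ₄/17-rescaled, k+2 ≤ m+K from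
8R+16 ≤ M, separation 2R+4 ≥ 34·13^k+4; small R trivial with C ≥ 2·(17·13)⁴); take CondResponse's
everywhere-bounded versions g^(a) at every depth a ≤ k (admissible since a+2 ≤ k+2 ≤ m+K and
13^a·uRec ≤ 13^k·uRec), write p_i − m_i = Σ_(a=0..k) D_i^(a) a.e. (D^(a) = g^(a)∘Q_a −
g^(a+1)∘Q_(a+1), D^(k) = g^(k)∘Q_k − m_i; p_i = g^(0)∘Q_0 a.e. because Q_0 = ofConfig generates
everything), expand the product over level assignments, put the factors at levels k−1, k (functions
of Q_(k−1)V since Q_k = blockAvg ∘ Q_(k−1), sup sizes ≤ 2C_R·13⁸·13^(−4k)) into the tilt Φ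
normalised by their sizes, apply TowerDecoupling to the factors at levels ≤ k−2 with s_i =
2C_R·13^(−4a_i), and re-sum: |E∏(p_i − m_i)| ≤ (Σ_j w(j))^n ≤ (C″·13^(−4k))^n ≤ ((C″·221⁴)/R⁴)^n.
[difficulty: provable-now] [Balaban1988Convergent, arXiv:2307.07619]

TWO-LAYER PLAN. Foreseen glued splits (not filed now): TowerDecoupling ⇐ TowerSmallField (the
multi-level bound restricted to tilts Φ supported on block fields that are small on the 17-block
neighbourhoods of the insertions at every depth ≤ k−1: Bałaban's small-field cluster expansion with
background-field propagators, exponential in the scale ratio) → TowerRoughField (the complement: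
rough block fields near some insertion; the bet is energy spreading/compactness at the rough
insertion plus deep-regime decay away from it) → glue by the regime sum (as in
BalabanFluctuationExport's 26272/26273 split, but in the deep regime). A BUDGETED variant (products
of (1+𝔈_i) on the right, joint moments as in BalabanMarkovExport's ShellLaw) is the fallback if the
ε → 0 soft-valley scenario of «Why it might fail» materialises.

KILL CRITERIA. A block field W at depth k−1 of positive conditional weight ≫ b^(−4n) under which two
exactly-centred level-a differences (a ≤ k−2) at separation 34·L^k have conditional covariance ≥
their sizes times (L^(a+1)/L^k)^4 — e.g. an engineered near-fully-frustrated coarse field whose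
constrained SU(2) interior carries an ordered soft mode — refutes TowerDecoupling as typed (then
only the budgeted variant survives); a refutation of CondResponse (26018) kills every
(Q)-architecture line including this one; FamilySeam/FloorsEngine deaths are shared with
BFE/BFluctE/BalabanMarkovExport.

NOT DECOMPOSED YET. The small-field/rough-field split of TowerDecoupling (Two-layer plan), the
choice of two absorbed top levels (c₀ = 1; any fixed c₀ works with constant 2C_R(c₀+1)L^(4c₀)), the
exponent 4+δ (any summable-against-L^(4t) rate suffices; exponential is expected), the level-0
identification p = E[p | Q_0] a.e. (ofConfig is a re-indexing), and the measure-theoretic packaging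
(explicit versions with orthogonality relations instead of Mathlib `condexp`, as in the sibling
routes).

CHEAPEST FALSIFIER. The lattice GFF in d = 4 with LINEAR block-mean constraints
(Bałaban–Gawędzki–Kupiainen linear averaging, L = 13, two or three levels): there E[φ(x)² | Q_a] is
an explicit quadratic form plus a constant, the level differences D^(a) are explicit, and the
multi-level bound is a finite-dimensional Gaussian covariance computation (Wick) — check that
Cov(D_x^(a), D_y^(a') | Q_(k−1)) at |x−y| = 34·L^k is ≤ (sizes)·(L^(a+1)/L^k)^(4+δ) uniformly in the
conditioning values (for a Gaussian the conditional covariance does not depend on them, so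
uniformity is free and only the RATE is tested); a power-law-only decay in the scale ratio (from
harmonic long-range modes surviving the block-mean constraints) would kill the exponent bet;
instrument row = the constrained-cooling re-run (kit/fbl_smallflux successor) measuring conditional
covariances of fine plaquettes given frozen coarse links at two depths.

NUMBERS. L = 13 in the glue: b = 13^k ∈ (13, 169, 2197, …) with R/221 < b ≤ R/17; top two levels
cost 2C_R·(2·13⁸) ≈ 1.6·10⁹·C_R in C″; deep levels cost 2C_R·C₁·13⁴·Σ_(t≥1)13^(−δt) =
2C_R·C₁·28561/(13^δ − 1); export constant C″·221⁴ ≈ 2.4·10⁹·C″; separation 34b+4 in lattice units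
between insertion coordinates (some direction, cyclic valMinAbs) as in BalabanMarkovExport;
decoupling is invoked only at scale ratios L^(k−a−1) ≥ 13, i.e. at ≥ 442 correlation lengths of the
depth-(a+1) constrained system.

DEFINITION REQUESTS. None: `Averaging.iter`, `BlockAveraging.blockAvg`, `su2Mean`, `ofConfig`,
`T4Family.P`, `Params.sitesPerDir`, `torusEOn`, `plane`, `torusLift`, `wilsonMeasure`,
`Transport.uRec` exist (lean check rc 0 of the one-line statements, line10/Sketch.lean, dependent
family `Q : (j : ℕ) → … → GaugeField (F.P K) j SU(2)` elaborates); the alt-closer registration of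
`Summit.QuantumFields.YangMills.Theses.BalabanLadder.UVSeamRec` (R407(b)) is a director/operator
action, not a definition.

Novelty: Searches (2026-08-28): tree `rg "iter .* (k - 1)|Q \(k - 1\)|martingale"
lean/Summits/QuantumFields/YangMills/Theses` → 0 route items telescope over block levels (every
(Q)-architecture item — 26017, 26018, 26272/26273, 26652–26654, 27367 — lives at ONE depth k; the
(K) lines use DLR cubes, no block tower); `ledger negatives --problem QuantumFields` (no negatives
on multi-level conditional expectations); corpus `lit search --hybrid "Polchinski equation
renormalisation group martingale log-Sobolev inequality correlation decay"` → textbook RG hits only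
[corpus:book:salmhofer1999-renormalization-introduction p.58]; `lit search "Bauerschmidt Bodineau
Polchinski equation log-Sobolev" --source all` → [corpus:paper:arxiv-2307.07619 p.25]
(backward-filtration martingale of the renormalised potential, scalar/spin systems),
arXiv:1907.12308, arXiv:2202.02295 (LSI for sine-Gordon / φ⁴ via the Polchinski flow),
[corpus:paper:arxiv-2307.11580] (Wilson–Itô diffusions); galaxy `"Polchinski flow|multiscale
Bakry|stochastic localization" --star all` → [galaxy:pdf:6972039037180720980] (stochastic
localization, convex bodies), [galaxy:pdf:4563267683490069920] (LSI mini-course) — no lattice-gauge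
or Bałaban-tower hit; galaxy `"Polchinski equation|renormalisation group martingale|multiscale
martingale" --star pdf` → functional-RG physics papers only. Nearest prior art: the Polchinski-flow
martingale (continuous Gaussian convolution semigroup, scalar fields) and, in the tree,
BalabanFluctuationExp  [refs: 1907.12308, 2202.02295, book:salmhofer1999-renormalization-introduction, paper:arxiv-2307.07619, paper:arxiv-2307.11580]

Barriers (technique_class: multiscale-rg, block-conditioning, martingale-tower, floors): - technique_class: multiscale-rg, block-conditioning, martingale-tower, floors
- Literature.Barriers.QuantumFields.UVStabilityNonUniqueness: TowerDecoupling/CondResponse are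
finite-torus statements at fixed (β, M) inside the UV window (bounds, not limits); the barrier
quantifies over uniqueness of continuum limits and does not bite; FamilySeam is where it could
(shared, priced).
- Literature.Barriers.QuantumFields.PerturbativeInvisibility: TowerDecoupling and CondResponse are
UPPER bounds of perturbative size (outside the barrier's class of claims); FloorsEngine's Q3 floor
is inside it — placed, not evaded (shared bet with v5(α)/BFE/BFluctE/BalabanMarkovExport).
- Literature.Barriers.QuantumFields.ToronPlaneAnticorrelation: does not bite — torons (constant
modes) are σ(Q_a)-measurable at every depth, hence cancel inside each level difference D^(a); no
sign claim is made.
- Discrete-subgroup freezing (file Literature/Barriers/QuantumFields/DiscreteSubgroupFreezing.lean,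
`actionGap_pos_of_finite`): does not apply — the group is SU(2) throughout (no finite-subgroup
approximation); the deep-regime decay is asked of the constrained continuous-group system.
- RG pathologies (van Enter–Fernández–Sokal [doi:10.1007/BF01048183], uncatalogued here): the
multi-level bound is uniform in the depth-(k−1) block field only through a bounded tilt and
intermediate levels are INTEGRATED, not conditioned (no sup over fine or intermediate data); the
residual exposure — near-central coarse holonom

sub-problem: YangMills · status: draft · opened planner-ym-idea-9-g3-0 2026-08-28T10:08:48Z · rev 0 · ledger route-QuantumFields-BalabanTowerExport
GENERATED by the gate from the ledger (D-0016/17). Provers cite these decls: `theorem foo : Summit.QuantumFields.YangMills.Theses.BalabanTowerExport.<Decl> := …` in Summits/QuantumFields/YangMills/Theorems/<Name>.lean.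
-/

namespace Summit.QuantumFields.YangMills.Theses.BalabanTowerExport

open scoped BigOperators Topology Manifold Classical MeasureTheory ProbabilityTheory Matrix InnerProductSpace ComplexConjugate ContinuousMap
open Filter Set Function TopologicalSpace MeasureTheory

attribute [summit_statement] _root_.YangMills

/-- item stmt-QuantumFields-27384 · crux · rank 2 · open · by planner
why it might fail: Uniformity in the depth-(k−1) block field via Φ: near-central coarse holonomies (angle π−ε, weight ≈ e^(−βπ²/2) per coarse plaquette) leave weakly pinned degenerate valleys of the constrained minimiser whose conditional correlations may decay slower than any fixed power of the scale ratio as ε → 0.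
sources: Balaban1985BackgroundPropagators, Balaban1985Averaging, Balaban1987RG1, Balaban1989LargeFieldII, Balaban1998FluctuationMeasures, arXiv:2307.07619
[crux] for every admissible L (odd, > 11) there are C₁ ≥ 0, δ > 0, β₄, ℓ₄ > 0 such that for β ≥ β₄,
on every family torus (F, K) with F.L = L and every depth k with k+2 ≤ m+K and L^k·uRec β ≤ ℓ₄: for
every m, every family of plane plaquettes p_i = p_(q_i, x_i) pairwise 34·L^k(+4)-separated
(cyclically, in some coordinate), every level assignment a_i with a_i + 2 ≤ k, every versions u_i of
E[p_i | Q_(a_i)] and h_i of E[p_i | Q_(a_i+1)] (bounded; u_i∘Q_(a_i), h_i∘Q_(a_i+1) measurable;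
orthogonality ∫(p_i − u_i∘Q_(a_i))·φ∘Q_(a_i) dμ = 0 and ∫(p_i − h_i∘Q_(a_i+1))·φ∘Q_(a_i+1) dμ = 0
for all bounded measurable tilts φ), every sup sizes s_i ≥ |u_i∘Q_(a_i) − h_i∘Q_(a_i+1)|, and every
tilt Φ with Φ∘Q_(k−1) measurable and |Φ| ≤ 1: |∫ ∏_i (u_i(Q_(a_i)V) − h_i(Q_(a_i+1)V)) · Φ(Q_(k−1)V)
dμ(V)| ≤ (∏_i C₁·((L^(a_i+1))/(L^k))^(4+δ)·s_i) · ∫ |Φ(Q_(k−1)V)| dμ(V), μ = SU(2) Wilson measure at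
β on the torus (F.P K).sitesPerDir 0. [difficulty: XL] -/
@[route_item "route-QuantumFields-BalabanTowerExport", crux]
def TowerDecoupling : Prop :=
  open MeasureTheory Literature.MathematicalPhysics.QuantumFieldTheory Literature.MathematicalPhysics.QuantumFieldTheory.Balaban1983to89 in open Literature.MathematicalPhysics.QuantumLattice (torusLift fundamentalLatticeRep) in open Summit.QuantumFields.YangMills.Cruxes.OSLegsFromFemtoAndGap.DlrCollarTransfer (plane) in open Summit.QuantumFields.YangMills.Cruxes.UV.TorusClass (torusEOn) in letI : MeasurableSpace (Matrix.specialUnitaryGroup (Fin 2) ℂ) := borel _; haveI : BorelSpace (Matrix.specialUnitaryGroup (Fin 2) ℂ) := ⟨rfl⟩; ∀ L : ℕ, Odd L → 11 < L → ∃ (C₁ δ β₄ ℓ₄ : ℝ), 0 < δ ∧ 0 < ℓ₄ ∧ 0 ≤ C₁ ∧ ∀ β : ℝ, β₄ ≤ β → ∀ (F : T4Continuum.T4Family) (K k : ℕ), F.L = L → k + 2 ≤ F.m + K → ((L : ℝ) ^ k) * Summit.QuantumFields.YangMills.Cruxes.UVSeamRec.Transport.uRec β ≤ ℓ₄ → haveI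 : NeZero ((F.P K).sitesPerDir 0) := ⟨Params.sitesPerDir_ne_zero _ _⟩; let Q : (j : ℕ) → GaugeConfig 4 ((F.P K).sitesPerDir 0) (Matrix.specialUnitaryGroup (Fin 2) ℂ) → GaugeField (F.P K) j (Matrix.specialUnitaryGroup (Fin 2) ℂ) := fun j V => Averaging.iter (fun i => BlockAveraging.blockAvg (P := F.P K) (j := i) su2Mean) j (ofConfig (P := F.P K) (j := 0) V); let μ := wilsonMeasure (d := 4) (L := ((F.P K).sitesPerDir 0)) (fundamentalLatticeRep 2).ρ β; let p : (Fin 4 × Fin 4) → (Fin 4 → ℤ) → GaugeConfig 4 ((F.P K).sitesPerDir 0) (Matrix.specialUnitaryGroup (Fin 2) ℂ) → ℝ := fun q x V => plane (Matrix.specialUnitaryGroup (Fin 2) ℂ) (fundamentalLatticeRep 2) q x (torusLift ((F.P K).sitesPerDir 0) V); ∀ (m : ℕ) (q : Fin m → Fin 4 × Fin 4) (x : Fin m → (Fin 4 → ℤ)) (a : Fin m → ℕ), (∀ i, (q i).1 < (q i).2) → (∀ i, a i + 2 ≤ k) → (∀ i j : Fin m, i ≠ j → ∃ κ : Fin 4,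 (34 * ((L : ℤ) ^ k) + 4) ≤ |((((x i κ - x j κ : ℤ) : ZMod ((F.P K).sitesPerDir 0))).valMinAbs : ℤ)|) → ∀ (u : (i : Fin m) → GaugeField (F.P K) (a i) (Matrix.specialUnitaryGroup (Fin 2) ℂ) → ℝ) (h : (i : Fin m) → GaugeField (F.P K) (a i + 1) (Matrix.specialUnitaryGroup (Fin 2) ℂ) → ℝ) (s : Fin m → ℝ), (∀ i, Measurable (fun V => u i (Q (a i) V))) → (∀ i, Measurable (fun V => h i (Q (a i + 1) V))) → (∀ i, ∃ D : ℝ, (∀ W, |u i W| ≤ D) ∧ (∀ W, |h i W| ≤ D)) → (∀ i, ∀ φ : GaugeField (F.P K) (a i) (Matrix.specialUnitaryGroup (Fin 2) ℂ) → ℝ, Measurable (fun V => φ (Q (a i) V)) → (∀ W, |φ W| ≤ 1) → ∫ V, (p (q i) (x i) V - u i (Q (a i) V)) * φ (Q (a i) V) ∂μ = 0) → (∀ i, ∀ φ : GaugeField (F.P K) (a i + 1) (Matrix.specialUnitaryGroup (Fin 2) ℂ) → ℝ, Measurable (fun V => φ (Q (a i + 1) V)) → (∀ W, |φ W| ≤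 1) → ∫ V, (p (q i) (x i) V - h i (Q (a i + 1) V)) * φ (Q (a i + 1) V) ∂μ = 0) → (∀ i V, |u i (Q (a i) V) - h i (Q (a i + 1) V)| ≤ s i) → ∀ Φ : GaugeField (F.P K) (k - 1) (Matrix.specialUnitaryGroup (Fin 2) ℂ) → ℝ, Measurable (fun V => Φ (Q (k - 1) V)) → (∀ W, |Φ W| ≤ 1) → |∫ V, (∏ i, (u i (Q (a i) V) - h i (Q (a i + 1) V))) * Φ (Q (k - 1) V) ∂μ| ≤ (∏ i, C₁ * ((L : ℝ) ^ (a i + 1) / (L : ℝ) ^ k) ^ (4 + δ) * s i) * ∫ V, |Φ (Q (k - 1) V)| ∂μ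

/-- item stmt-QuantumFields-26018 · crux · rank 3 · open · by planner
why it might fail: «sup over all W» must survive block fields far in the tail (maximally frustrated coarse holonomies, near-degenerate su2Mean averages) where E[p_x | W] − E p_x is set by the forced fine curvature; if some W forces action concentration near x beyond O(b⁻⁴) the sup form is false.
sources: Balaban1985BackgroundPropagators, Balaban1985Averaging, Balaban1987RG1, Balaban1998FluctuationMeasures, Luscher1983
[crux] for every admissible L there are C ≥ 0, β₄, ℓ₄ > 0 such that for β ≥ β₄, every family torus
(F, K) with F.L = L, every depth k with k+1 ≤ m+K and L^k·uRec β ≤ ℓ₄, and every plane plaquette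
p_x: there is a function g on block fields with g∘Q_k measurable, |g(W) − E p_x| ≤ C/(L^k)⁴ for
EVERY block field W, and ∫ (p_x − g∘Q_k)·φ∘Q_k dμ = 0 for every test function φ of the block field
with φ∘Q_k measurable and |φ| ≤ 1 (g is a version of E[p_x | Q_k] within C/b⁴ of the mean
everywhere: one-point conditional response to the block field, sup form). [difficulty: L] -/
@[route_item "route-QuantumFields-BalabanTowerExport", crux]
def CondResponse : Prop :=
  open MeasureTheory Literature.MathematicalPhysics.QuantumFieldTheory Literature.MathematicalPhysics.QuantumFieldTheory.Balaban1983to89 in open Literature.MathematicalPhysics.QuantumLattice (torusLift fundamentalLatticeRep) in open Summit.QuantumFields.YangMills.Cruxes.OSLegsFromFemtoAndGap.DlrCollarTransfer (plane) in open Summit.QuantumFields.YangMills.Cruxes.UV.TorusClass (torusEOn) in letI : MeasurableSpace (Matrix.specialUnitaryGroup (Fin 2) ℂ) := borel _; haveI : BorelSpace (Matrix.specialUnitaryGroup (Fin 2) ℂ) := ⟨rfl⟩; ∀ L : ℕ, Odd L → 11 < L → ∃ (C β₄ ℓ₄ : ℝ), 0 < ℓ₄ ∧ 0 ≤ C ∧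 ∀ β : ℝ, β₄ ≤ β → ∀ (F : T4Continuum.T4Family) (K k : ℕ), F.L = L → k + 1 ≤ F.m + K → ((L : ℝ) ^ k) * Summit.QuantumFields.YangMills.Cruxes.UVSeamRec.Transport.uRec β ≤ ℓ₄ → haveI : NeZero ((F.P K).sitesPerDir 0) := ⟨Params.sitesPerDir_ne_zero _ _⟩; let Q : GaugeConfig 4 ((F.P K).sitesPerDir 0) (Matrix.specialUnitaryGroup (Fin 2) ℂ) → GaugeField (F.P K) k (Matrix.specialUnitaryGroup (Fin 2) ℂ) := fun V => Averaging.iter (fun j => BlockAveraging.blockAvg (P := F.P K) (j := j) su2Mean) k (ofConfig (P := F.P K) (j := 0) V); let μ := wilsonMeasure (d := 4) (L := (F.P K).sitesPerDir 0) (fundamentalLatticeRep 2).ρ β; ∀ (q : Fin 4 × Fin 4) (x : Fin 4 → ℤ), q.1 < q.2 → ∃ g : GaugeField (F.P K) k (Matrix.specialUnitaryGroup (Fin 2) ℂ) → ℝ, Measurable (fun V => g (Q V)) ∧ (∀ W, |g W - torusEOn (Matrix.specialUnitaryGroup (Fin 2) ℂ) (fundamentalLatticeRep 2) β ((F.P K).sitesPerDir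 0) (plane (Matrix.specialUnitaryGroup (Fin 2) ℂ) (fundamentalLatticeRep 2) q x)| ≤ C / ((L : ℝ) ^ k) ^ 4) ∧ ∀ φ : GaugeField (F.P K) k (Matrix.specialUnitaryGroup (Fin 2) ℂ) → ℝ, Measurable (fun V => φ (Q V)) → (∀ W, |φ W| ≤ 1) → ∫ V, (plane (Matrix.specialUnitaryGroup (Fin 2) ℂ) (fundamentalLatticeRep 2) q x (torusLift ((F.P K).sitesPerDir 0) V) - g (Q V)) * φ (Q V) ∂μ = 0

/-- item stmt-QuantumFields-25033 · crux · rank 4 · open · by planner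
why it might fail: The transfer from the sides 2·Lⁿ to all tori needs a volume-monotonicity or thermodynamic-limit comparison of 6-plaquette moments at fixed β that no correlation inequality provides for SU(2); finite odd tori may carry toron shifts ≥ C/R⁴ at the smallest admissible sizes.
sources: Balaban1988Convergent, Luscher1983, Balaban1985Averaging
[crux] for every admissible L: ceilings `MomentBounds6OnSides … uRec {2·Lⁿ : n ≥ 1}` on the cofinal
class of even L-adic tori imply `MomentBounds6 SU(2) fund uRec` on all odd tori T⁴_{2S+1} with 8R+16
≤ 2S+1 (same window R·uRec ≤ ℓ₄′, constants may change) — finite-size independence of local centred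
plaquette moments at weak coupling; mechanism named: femto tori (M·uRec ≲ 1) by direct small-volume
control, large tori by volume comparison through clustering (BIJ84 p.22: needs mass extraction).
[deps: FamilyCeilings] [difficulty: XL] -/
@[route_item "route-QuantumFields-BalabanTowerExport", crux]
def FamilySeam : Prop :=
  ∀ L : ℕ, Odd L → 11 < L → Summit.QuantumFields.YangMills.Cruxes.UV.TorusClass.MomentBounds6OnSides (Matrix.specialUnitaryGroup (Fin 2) ℂ) (Literature.MathematicalPhysics.QuantumLattice.fundamentalLatticeRep 2) Summit.QuantumFields.YangMills.Cruxes.UVSeamRec.Transport.uRec {M | ∃ n : ℕ, 1 ≤ n ∧ M = 2 * L ^ n} → letI : MeasurableSpace (Matrix.specialUnitaryGroup (Fin 2) ℂ) := borel _; haveI : BorelSpace (Matrix.specialUnitaryGroup (Fin 2) ℂ) := ⟨rfl⟩; Summit.QuantumFields.YangMills.Cruxes.OSLegsFromFemtoAndGap.DlrCollarTransfer.MomentBounds6 (Matrix.specialUnitaryGroup (Fin 2) ℂ) (Literature.MathematicalPhysics.QuantumLattice.fundamentalLatticeRep 2) Summit.QuantumFields.YangMills.Cruxes.UVSeamRec.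Transport.uRec

/-- item stmt-QuantumFields-25034 · crux · rank 5 · open · by planner
why it might fail: The Q3 floor is a non-perturbative lower bound on a connected three-point function at the physical scale; perturbatively it is O(g²) → 0 and no printed argument bounds it below uniformly in β (PerturbativeInvisibility barrier applies head-on; shared bet with v5(α)/BFE).
sources: Balaban1989LargeFieldII, Luscher1983
[crux] the registered v5(α) floors engine VERBATIM (shared item; owner desk of 19353/NT-under-UV): a
unit a(β) > 0 with a/uRec → c₀ > 0 in which SU(2)/fundamental has a compact-witness Q2 floor
(θ-reflected pair, support in {y₀ > 0}) and a Q3 floor (three disjointly supported Schwartz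
functions), ε > 0 uniform for β ≥ β₅ and boxes a(β)·L ≥ Λ₅. [difficulty: XL] -/
@[route_item "route-QuantumFields-BalabanTowerExport", crux]
def FloorsEngine : Prop :=
  open Filter Topology Literature.MathematicalPhysics.QuantumLattice Summit.QuantumFields.YangMills.Cruxes.OSLegsFromFemtoAndGap.DlrCollarTransfer in letI : MeasurableSpace (Matrix.specialUnitaryGroup (Fin 2) ℂ) := borel _; haveI : BorelSpace (Matrix.specialUnitaryGroup (Fin 2) ℂ) := ⟨rfl⟩; ∃ (a : ℝ → ℝ) (c₀ : ℝ), 0 < c₀ ∧ (∀ β, 0 < a β) ∧ Tendsto (fun β => a β / Summit.QuantumFields.YangMills.Cruxes.UVSeamRec.Transport.uRec β) atTop (nhds c₀) ∧ (∃ (v : SchwartzMap (EuclideanSpace ℝ (Fin 4)) ℝ) (ε β₅ Λ₅ : ℝ), HasCompactSupport (v : EuclideanSpace ℝ (Fin 4) → ℝ) ∧ tsupport (v : EuclideanSpace ℝ (Fin 4) → ℝ) ⊆ {y : EuclideanSpace ℝ (Fin 4) | 0 < y 0} ∧ 0 < ε ∧ ∀ β : ℝ, β₅ ≤ β → ∀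 L : ℕ, Λ₅ ≤ a β * L → ε ≤ Q2 (Matrix.specialUnitaryGroup (Fin 2) ℂ) (fundamentalLatticeRep 2) β L (a β) (thetaTest 4 v) v) ∧ (∃ (f g h : SchwartzMap (EuclideanSpace ℝ (Fin 4)) ℝ) (ε β₅ Λ₅ : ℝ), HasCompactSupport (f : EuclideanSpace ℝ (Fin 4) → ℝ) ∧ HasCompactSupport (g : EuclideanSpace ℝ (Fin 4) → ℝ) ∧ HasCompactSupport (h : EuclideanSpace ℝ (Fin 4) → ℝ) ∧ Disjoint (tsupport (f : EuclideanSpace ℝ (Fin 4) → ℝ)) (tsupport (g : EuclideanSpace ℝ (Fin 4) → ℝ)) ∧ Disjoint (tsupport (g : EuclideanSpace ℝ (Fin 4) → ℝ)) (tsupport (h : EuclideanSpace ℝ (Fin 4) → ℝ)) ∧ Disjoint (tsupport (f : EuclideanSpace ℝ (Fin 4) → ℝ)) (tsupport (h : EuclideanSpace ℝ (Fin 4) → ℝ)) ∧ 0 < ε ∧ ∀ β : ℝ, β₅ ≤ β → ∀ L : ℕ, Λ₅ ≤ a β * L → ε ≤ |Q3 (Matrix.specialUnitaryGroup (Fin 2)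 ℂ) (fundamentalLatticeRep 2) β L (a β) f g h|)

/-- item stmt-QuantumFields-27385 · support · rank 9 · closed · proved by Summit.QuantumFields.YangMills.Theorems.BalabanTowerExport.towerExportGlue_proof (prover) · by planner
sources: Balaban1988Convergent, arXiv:2307.07619
[support] TowerDecoupling → CondResponse → BalabanFamilyExport.FamilyCeilings: take L := 13, class
tori M = 2·13ⁿ realised as (F.P K).sitesPerDir 0; given R ≥ 17·13 pick k ≥ 1 with 13^k ≤ R/17 <
13^(k+1) (window 13^k·uRec ≤ ℓ₄ from R·uRec ≤ ℓ₄/17-rescaled, k+2 ≤ m+K from 8R+16 ≤ M, separation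
2R+4 ≥ 34·13^k+4; small R trivial with C ≥ 2·(17·13)⁴); take CondResponse's everywhere-bounded
versions g^(a) at every depth a ≤ k (admissible since a+2 ≤ k+2 ≤ m+K and 13^a·uRec ≤ 13^k·uRec),
write p_i − m_i = Σ_(a=0..k) D_i^(a) a.e. (D^(a) = g^(a)∘Q_a − g^(a+1)∘Q_(a+1), D^(k) = g^(k)∘Q_k −
m_i; p_i = g^(0)∘Q_0 a.e. because Q_0 = ofConfig generates everything), expand the product over
level assignments, put the factors at levels k−1, k (functions of Q_(k−1)V since Q_k = blockAvg ∘
Q_(k−1), sup sizes ≤ 2C_R·13⁸·13^(−4k)) into the tilt Φ normalised by their sizes, apply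
TowerDecoupling to the factors at levels ≤ k−2 with s_i = 2C_R·13^(−4a_i), and re-sum: |E∏(p_i −
m_i)| ≤ (Σ_j w(j))^n ≤ (C″·13^(−4k))^n ≤ ((C″·221⁴)/R⁴)^n. [difficulty: provable-now] -/
@[route_item "route-QuantumFields-BalabanTowerExport", crux]
def TowerExportGlue : Prop :=
  Summit.QuantumFields.YangMills.Theses.BalabanTowerExport.TowerDecoupling → Summit.QuantumFields.YangMills.Theses.BalabanTowerExport.CondResponse → Summit.QuantumFields.YangMills.Theses.BalabanFamilyExport.FamilyCeilings

-- `TowerExportGlue` holds: proved by `Summit.QuantumFields.YangMills.Theorems.BalabanTowerExport.towerExportGlue_proof` (its module imports this route file, so no `_holds` link can be stated here).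

/-- item stmt-QuantumFields-27386 · assembly · rank 1 · closed · proved by Summit.QuantumFields.YangMills.Theorems.balabanTowerExport_assembly (prover) · by planner
sources: Balaban1988Convergent, arXiv:2307.07619
[assembly] TowerDecoupling → TowerExportGlue → CondResponse → FamilySeam → FloorsEngine → the spine
crux UVSeamRec (the deciding theorem `closes` is this implication, proved). -/
@[route_item "route-QuantumFields-BalabanTowerExport"]
def Assembly : Prop :=
  Summit.QuantumFields.YangMills.Theses.BalabanTowerExport.TowerDecoupling → Summit.QuantumFields.YangMills.Theses.BalabanTowerExport.TowerExportGlue → Summit.QuantumFields.YangMills.Theses.BalabanTowerExport.CondResponse → Summit.QuantumFields.YangMills.Theses.BalabanTowerExport.FamilySeam → Summit.QuantumFields.YangMills.Theses.BalabanTowerExport.FloorsEngine → Summit.QuantumFields.YangMills.Theses.BalabanLadder.UVSeamRec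

-- `Assembly` holds: proved by `Summit.QuantumFields.YangMills.Theorems.balabanTowerExport_assembly` (its module imports this route file, so no `_holds` link can be stated here).

/-! D-0027 §2.1 — DECIDING THEOREM (planner-authored via `route open/edit --closes-file`; by planner-ym-idea-9-g3-0 2026-08-28T10:08:48Z):
its hypotheses are this route's items and its conclusion the sub-problem Statement (glue_lint), and it elaborates with this file. -/

@[closes "route-QuantumFields-BalabanTowerExport"] theorem closes (h₁ : TowerDecoupling) (h₂ : TowerExportGlue) (h₃ : CondResponse) (h₄ : FamilySeam) (h₅ : FloorsEngine) :
    Summit.QuantumFields.YangMills.Theses.BalabanLadder.UVSeamRec :=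
  Summit.QuantumFields.YangMills.Theses.BalabanFamilyExport.closes (h₂ h₁ h₃) h₄ h₅

end Summit.QuantumFields.YangMills.Theses.BalabanTowerExport
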